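import Literature.NumberTheory.LFunctions.WeilTwoPrimeDeflL2Base
import Literature.NumberTheory.LFunctions.WeilBlockRowsPZ
import HarnessLib

/-!
# Deflated two-prime certificate L2: the factored even inverse agrees with `D`, rows 88–95

`WeilCert.checkDnRow` (even block) for certificate L2, by `decide +kernel`. Pure proof file.
-/

noncomputable section

namespace Literature.NumberTheory.LFunctions

set_option maxHeartbeats 0 in
/-- Row 88 of `DnE/LsE` is row 88 of the even `D` (certificate L2). [folklore] -/
theorem checkDnRow0_88_weilCertDeflL2 : weilCertDeflL2Base.checkDnRow weilCertDeflL2DnE weilCertDeflL2LsE 0 88 = true := by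
  decide +kernel

set_option maxHeartbeats 0 in
/-- Row 89 of `DnE/LsE` is row 89 of the even `D` (certificate L2). [folklore] -/
theorem checkDnRow0_89_weilCertDeflL2 : weilCertDeflL2Base.checkDnRow weilCertDeflL2DnE weilCertDeflL2LsE 0 89 = true := by
  decide +kernel

set_option maxHeartbeats 0 in
/-- Row 90 of `DnE/LsE` is row 90 of the even `D` (certificate L2). [folklore] -/
theorem checkDnRow0_90_weilCertDeflL2 : weilCertDeflL2Base.checkDnRow weilCertDeflL2DnE weilCertDeflL2LsE 0 90 = true := by
  decide +kernel

set_option maxHeartbeats 0 in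
/-- Row 91 of `DnE/LsE` is row 91 of the even `D` (certificate L2). [folklore] -/
theorem checkDnRow0_91_weilCertDeflL2 : weilCertDeflL2Base.checkDnRow weilCertDeflL2DnE weilCertDeflL2LsE 0 91 = true := by
  decide +kernel

set_option maxHeartbeats 0 in
/-- Row 92 of `DnE/LsE` is row 92 of the even `D` (certificate L2). [folklore] -/
theorem checkDnRow0_92_weilCertDeflL2 : weilCertDeflL2Base.checkDnRow weilCertDeflL2DnE weilCertDeflL2LsE 0 92 = true := by
  decide +kernel

set_option maxHeartbeats 0 in
/-- Row 93 of `DnE/LsE` is row 93 of the even `D` (certificate L2). [folklore] -/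
theorem checkDnRow0_93_weilCertDeflL2 : weilCertDeflL2Base.checkDnRow weilCertDeflL2DnE weilCertDeflL2LsE 0 93 = true := by
  decide +kernel

set_option maxHeartbeats 0 in
/-- Row 94 of `DnE/LsE` is row 94 of the even `D` (certificate L2). [folklore] -/
theorem checkDnRow0_94_weilCertDeflL2 : weilCertDeflL2Base.checkDnRow weilCertDeflL2DnE weilCertDeflL2LsE 0 94 = true := by
  decide +kernel

set_option maxHeartbeats 0 in
/-- Row 95 of `DnE/LsE` is row 95 of the even `D` (certificate L2). [folklore] -/
theorem checkDnRow0_95_weilCertDeflL2 : weilCertDeflL2Base.checkDnRow weilCertDeflL2DnE weilCertDeflL2LsE 0 95 = true := by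
  decide +kernel


end Literature.NumberTheory.LFunctions
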